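import Summits.HodgeConjecture.HodgeConjecture.Theorems.Ring2AbelianAllAndrePrimitiveLift
import Summits.HodgeConjecture.HodgeConjecture.Theorems.Ring2AbelianAllAndreNumericalCM
import Summits.HodgeConjecture.HodgeConjecture.Theorems.Ring2AbelianAllAndreSpreadVerdier
import Summits.HodgeConjecture.HodgeConjecture.Theorems.Ring2AbelianAllAndreWeilPencilsNumerical
import HarnessLib

/-!
# Ring 2 · sub-cell AbelianAll (ALL ABELIAN VARIETIES), André axis, part XXI-b — THE ROWS OF THE PRIMITIVE LIFT:
# `d = 4` (the smallest open instance of `B_min` is the lift of the invariant PRIMITIVE algebraic `(2,2)`-classes of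
# the abelian fourfold fibre), exactness at fibres satisfying HC, and the node level under `HC_CM`:
# (L) ⟺ Num^CM ⟺ [CM primitive lift], the cell row `HC_CM ∧ [CM primitive lift] ⟹ HC_AV`, on-path, exactness
# modulo Verdier; the `E`-power / W₆ reading

HONEST FRAMING (page 1, verbatim): **research route, not a corollary; conditional on HC_CM plus one named
minimal statement.** Cell line: research route conditional on HC_CM; not a corollary; Q11.4-sentence-2
already refuted in dim ≥ 3. Nothing in this file proves a case of the Hodge conjecture for an abelian variety.
`HC_CM` = `Theses.RankFourFaces.CMAbelianHodge` (stmt-HodgeConjecture-3052) is a BINDER wherever it occurs; `HC_AV` =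
`Theses.PadicSemiregularLift.HodgeAbelianVarieties`; `h₂₁` = `Andre1996.andre1996_cmAnchoredPencil` and `Verdier` =
`Motives.Verdier1976_genericLocalTriviality` are Literature named facts carried as BINDERS; item
`Theses.RankFourFaces.CMToAbelian` (stmt-16267) OPEN and not closed here. Seat `pub-hodge-ring2-ab-andre-2`, gen 13 (sequel
of part XXI-a; brief (ii)/(iii)).

## Content

Notation as in part XXI-a: (L)_t(p) = `(j_t^*)⁻¹ N^p(X_t) ≤ N^p(𝒳) + ker j_t^*`; (Num_t)(p,q) = conjecture D for the
fibre-supported classes `j_{t*} N^q(X_t)` against `N^p(𝒳)` (parts XVIII-a–c, inline); (Prim)_t(r) = every `κ`-primitive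
algebraic class of degree `2r` on `X_t` lying in `Im j_t^*` lies in `j_t^* N^r(𝒳)`, for a global algebraic class `K`
polarising every fibre (part XXI-a §3) and `κ = j_t^* K`.

* §4 `d = 4` (compact pencils of abelian FOURFOLDS, total space a fivefold): **(Prim)_t(2) ⟹ (L)_t(p) for every `p`**
  (`comap_le_sup_of_relDim_four_of_primitiveLift_two`); ⟹ (Num_t)(2,2) at a fibre with `HC²`; **at a fibre with `HC²`
  (e.g. a CM fibre under `HC_CM`): (Num_t)(2,2) ⟺ (Prim)_t(2)** — the smallest open instance of `Num^CM` (part XVIII-c: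
  `d = 4`, bidegree `(2,2)`) IS: "every monodromy-invariant `κ`-primitive algebraic `(2,2)`-class of the CM abelian
  fourfold `X_t` is cut out by a codimension-2 cycle of the fivefold `𝒳`" (find-the-cycle form); Abdulali's (1.1)_f for
  fourfold pencils from (Prim)(2) at every point.
* §5 at a fibre satisfying HC in all degrees (`A(X_t, κ)` from HC, the tree's `standardConjectureA_of_hodgeClasses_algebraic`):
  **[(Num_t) in every bidegree] ⟺ [(Prim)_t(r) for `4 ≤ 2r ≤ d`]**; at CM points under `HC_CM`.
* §6 node level, `HC_CM` a binder: **(L) ⟺ [CM primitive lift]** (`cmFibreAlgebraicLift_iff_cmPrimitiveLift_of_HC_CM`; the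
  direction (L) ⟹ [CM primitive lift] is fact-free and `HC_CM`-free), **Num^CM ⟺ [CM primitive lift]**, the cell row
  **`h₂₁ → HC_CM → [CM primitive lift] → HC_AV`**, on-path `HodgeConjecture ⟹ [CM primitive lift]`, **`HC_AV ⟺ HC_CM ∧
  [CM primitive lift]` modulo [h₂₁, Verdier]** (part XX-a), and the item reading `CMToAbelian`. The bracket is written as a
  display-only `local notation3` `CMPrimitiveLift[]` (NO definition is made; REFEREE-AB F-ab-79's one-name rule is met by
  the existing node `CMPointedPencilNumerical`, to which it is equivalent under `HC_CM`).
* §7 `E`-power points (no `HC_CM`: the Hodge conjecture of a fibre `≅ Eᴺ`, `E` CM, is the tree theorem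
  `hodgeConjectureFor_fiberOver_of_mem_cmPowerLocus`): (Prim) at `E`-power points ⟹ the lift in every degree ⟹ part XIX-f's
  `NumE[d, p, q]` in every bidegree; hence `(W_E)₃ ∧ PrimE[6] ⟹ WeilSixfolds` — weaker-or-EQUAL to part XIX-f's row as a
  theorem (PrimE[6] ⟹ NumE[6,3,3]), recorded only to state the W₆ find-the-cycle problem in primitive form: lift the
  invariant primitive algebraic classes of `H⁴(E⁶)` and `H⁶(E⁶)` to codimension-2 resp. -3 cycles of the sevenfold.

HONEST STATUS. Nothing here is fact-free progress on `HC_AV`: under `HC_CM` all André-axis nodes are equivalent to the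
complement of `HC_AV` (parts XIX/XX), so [CM primitive lift] is EQUIVALENT to Num^CM, (L), (4), (2), F_CM under `HC_CM`
[h₂₁, Verdier] — not weaker. What is new is the SHAPE: the coprimitive part of `B_min` is inherited from lower degree
(unconditionally in degree 4), so `B_min` is a statement about finitely many primitive degrees of the CM fibre, and for
abelian-fourfold pencils about ONE space `P⁴(X_t) ∩ N²(X_t) ∩ Im j_t^*`. 'Minimal' is claimed nowhere.

EDGE LABELS (RING2-MAP §AbelianAll gen 13): §4 K (no fact; `HC²(X_t)` displayed where used) / K[HC_CM]; §5 K[HC(X_t)] /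
K[HC_CM]; §6 K[HC_CM], the HC_AV row K[h₂₁, HC_CM], the iff K[h₂₁, Verdier]; §7 K (no fact, no `HC_CM`).
References: Kleiman1968AlgebraicCycles (§3); Lieberman1968 (Thm. 1); Grothendieck1968 (§3 p. 196); Andre1996Motifs (§5.1,
Lemme 6.3.1, §6.3, Remarque 2); Milne2020HodgeClassesAV (Prop. 1); Abdulali1994FamiliesAV ((1.1), p. 1122); Verdier1976
(Cor. 5.1); vanGeemen1994HodgeAV (Thm. 4.3); VoisinHodgeI2002 (§6.2.3).
-/

noncomputable section

set_option linter.dupNamespace false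

namespace Summit.HodgeConjecture.HodgeConjecture.Ring2.AbelianAll

open CategoryTheory AlgebraicGeometry
open Literature.AlgebraicGeometry Literature.AlgebraicGeometry.Motives
open Literature.AlgebraicGeometry.HodgeTheory
open Literature.AlgebraicTopology.SingularHomology (singularCohomology cupProduct)
open Literature.Geometry.Kaehler (lefschetzOperator lefschetzPow HasHardLefschetzProperty)
open Literature.AlgebraicGeometry.Deligne1982 (cmLocus)
open Literature.AlgebraicGeometry.Abdulali1994 (InvariantCyclesHoldFor)
open Literature.AlgebraicGeometry.Andre1996 (andre1996_cmAnchoredPencil)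
open Summit.HodgeConjecture.HodgeConjecture.Theses
open Summit.HodgeConjecture.HodgeConjecture.Ring2.Hypotheses (cmPowerLocus)

variable {𝒳 S : SchemeOver ℂ}

/-! ## §4 `d = 4`: the smallest open instance of `B_min` is the primitive `(2,2)`-lift -/

/-- **`d = 4`: THE WHOLE LIFT AT `t` FROM THE PRIMITIVE `(2,2)`-LIFT.** For a compact pencil of abelian FOURFOLDS (total
space a fivefold) and a point `t`: if every `κ`-primitive algebraic class of degree `4` on `X_t` lying in `Im j_t^*` lies
in `j_t^* N²(𝒳)`, then (L)_t holds in EVERY degree (degrees `≠ 4` are unconditional, part XVIII-i). The first open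
instance of the André-axis lift is thereby a statement about the INVARIANT PRIMITIVE middle cohomology of the abelian
fourfold fibre only. [cite: Lieberman1968, Thm. 1] [cite: Kleiman1968AlgebraicCycles, §3] [cite: Milne2020HodgeClassesAV, Prop. 1 (p. 7)] -/
theorem comap_le_sup_of_relDim_four_of_primitiveLift_two {f : 𝒳 ⟶ S} (hf : IsCompactAbelianPencil f 4)
    (t : ComplexPoints S) {K : complexBetti 𝒳 2} (hKalg : K ∈ algebraicClasses 𝒳 1)
    (hK : ∀ s : ComplexPoints S, HasHardLefschetzProperty (complexBetti.map (fiberι f s) 2 K) 4)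
    (hKt : IsPolarizationClass 4 (fiberOver f t) (complexBetti.map (fiberι f t) 2 K))
    (hPrim : ∀ ξ ∈ algebraicClasses (fiberOver f t) 2,
      ξ ∈ primitiveClasses (complexBetti.map (fiberι f t) 2 K) 4 (2 * 2) →
      ξ ∈ LinearMap.range (complexBetti.map (fiberι f t) (2 * 2)).hom →
      ξ ∈ (algebraicClasses 𝒳 2).map (complexBetti.map (fiberι f t) (2 * 2)).hom) (p : ℕ) :
    (algebraicClasses (fiberOver f t) p).comap (complexBetti.map (fiberι f t) (2 * p)).hom ≤
      algebraicClasses 𝒳 p ⊔ LinearMap.ker (complexBetti.map (fiberι f t) (2 * p)).hom := by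
  refine comap_le_sup_of_primitiveLift hf t hKalg hK hKt p (fun p' r' q' _ h2 h3 h4 ↦ ?_) (fun r h2 _ h4 ↦ ?_)
  · exact surjOn_lefschetzPow_algebraicClasses_of_le_one (hf.isSmoothProjective_fiberOver t) hKt (by omega) h3 h4
  · obtain rfl : r = 2 := by omega
    exact hPrim

/-- **`d = 4`: (Num_t)(2,2) — conjecture D for the fibre-supported codimension-3 cycles of the fivefold — follows from the
primitive `(2,2)`-lift** (part XVIII-i's `comap_le_sup_of_relDim_four` read backwards through exactness needs HC at the
fibre; this direction does not). [cite: Kleiman1968AlgebraicCycles, §3 (D(X))] [cite: Lieberman1968, Thm. 1] -/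
theorem numerical_two_two_of_primitiveLift_two_of_hodge {f : 𝒳 ⟶ S} (hf : IsCompactAbelianPencil f 4)
    (t : ComplexPoints S) {K : complexBetti 𝒳 2} (hKalg : K ∈ algebraicClasses 𝒳 1)
    (hK : ∀ s : ComplexPoints S, HasHardLefschetzProperty (complexBetti.map (fiberι f s) 2 K) 4)
    (hKt : IsPolarizationClass 4 (fiberOver f t) (complexBetti.map (fiberι f t) 2 K))
    (hp : ∀ c : complexBetti (fiberOver f t) (2 * 2), IsRationalClass c →
      IsOfHodgeType 4 (fiberOver f t) (2 * 2) 2 2 c → c ∈ algebraicClasses (fiberOver f t) 2)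
    (hPrim : ∀ ξ ∈ algebraicClasses (fiberOver f t) 2,
      ξ ∈ primitiveClasses (complexBetti.map (fiberι f t) 2 K) 4 (2 * 2) →
      ξ ∈ LinearMap.range (complexBetti.map (fiberι f t) (2 * 2)).hom →
      ξ ∈ (algebraicClasses 𝒳 2).map (complexBetti.map (fiberι f t) (2 * 2)).hom) :
    ∀ b ∈ algebraicClasses (fiberOver f t) 2,
      (∀ a ∈ algebraicClasses 𝒳 2,
        cupProduct (show 2 * 2 + 2 * (2 + 1) = 2 * (4 + 1) by omega) a (fiberGysin hf t 2 b) = 0) →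
        fiberGysin hf t 2 b = 0 :=
  numerical_of_comap_le_sup_of_hodge hf t (show 2 + 2 = 4 by rfl) hp
    (comap_le_sup_of_relDim_four_of_primitiveLift_two hf t hKalg hK hKt hPrim 2)

/-- **`d = 4`, EXACTNESS AT A FIBRE SATISFYING `HC²`: (Num_t)(2,2) ⟺ (Prim)_t(2).**
[cite: Kleiman1968AlgebraicCycles, §3 (D(X))] [cite: Milne2020HodgeClassesAV, Prop. 1 (p. 7)] -/
theorem numerical_two_two_iff_primitiveLift_two_of_hodge {f : 𝒳 ⟶ S} (hf : IsCompactAbelianPencil f 4)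
    (t : ComplexPoints S) {K : complexBetti 𝒳 2} (hKalg : K ∈ algebraicClasses 𝒳 1)
    (hK : ∀ s : ComplexPoints S, HasHardLefschetzProperty (complexBetti.map (fiberι f s) 2 K) 4)
    (hKt : IsPolarizationClass 4 (fiberOver f t) (complexBetti.map (fiberι f t) 2 K))
    (hp : ∀ c : complexBetti (fiberOver f t) (2 * 2), IsRationalClass c →
      IsOfHodgeType 4 (fiberOver f t) (2 * 2) 2 2 c → c ∈ algebraicClasses (fiberOver f t) 2) :
    (∀ b ∈ algebraicClasses (fiberOver f t) 2,
      (∀ a ∈ algebraicClasses 𝒳 2,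
        cupProduct (show 2 * 2 + 2 * (2 + 1) = 2 * (4 + 1) by omega) a (fiberGysin hf t 2 b) = 0) →
        fiberGysin hf t 2 b = 0) ↔
    ∀ ξ ∈ algebraicClasses (fiberOver f t) 2,
      ξ ∈ primitiveClasses (complexBetti.map (fiberι f t) 2 K) 4 (2 * 2) →
      ξ ∈ LinearMap.range (complexBetti.map (fiberι f t) (2 * 2)).hom →
      ξ ∈ (algebraicClasses 𝒳 2).map (complexBetti.map (fiberι f t) (2 * 2)).hom :=
  (numerical_iff_comap_le_sup_of_hodge hf t (show 2 + 2 = 4 by rfl) hp hp).trans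
    (comap_le_sup_two_iff_primitiveLift_two hf t hKalg hK hKt)

/-- **`d = 4`, AT A CM POINT UNDER `HC_CM` (a BINDER): (Num_t)(2,2) ⟺ (Prim)_t(2)** — the smallest open instance of
`Num^CM` is the statement "every monodromy-invariant `κ`-primitive algebraic `(2,2)`-class of the CM abelian fourfold
`X_t` is cut out by a codimension-2 cycle of the fivefold `𝒳`". [cite: Andre1996Motifs, §6.3 a) (p. 33)]
[cite: Kleiman1968AlgebraicCycles, §3 (D(X))] -/
theorem numerical_two_two_iff_primitiveLift_two_of_HC_CM (hCM : RankFourFaces.CMAbelianHodge) {f : 𝒳 ⟶ S}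
    (hf : IsCompactAbelianPencil f 4) {t : ComplexPoints S} (ht : t ∈ cmLocus f 4) {K : complexBetti 𝒳 2}
    (hKalg : K ∈ algebraicClasses 𝒳 1)
    (hK : ∀ s : ComplexPoints S, HasHardLefschetzProperty (complexBetti.map (fiberι f s) 2 K) 4)
    (hKt : IsPolarizationClass 4 (fiberOver f t) (complexBetti.map (fiberι f t) 2 K)) :
    (∀ b ∈ algebraicClasses (fiberOver f t) 2,
      (∀ a ∈ algebraicClasses 𝒳 2,
        cupProduct (show 2 * 2 + 2 * (2 + 1) = 2 * (4 + 1) by omega) a (fiberGysin hf t 2 b) = 0) →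
        fiberGysin hf t 2 b = 0) ↔
    ∀ ξ ∈ algebraicClasses (fiberOver f t) 2,
      ξ ∈ primitiveClasses (complexBetti.map (fiberι f t) 2 K) 4 (2 * 2) →
      ξ ∈ LinearMap.range (complexBetti.map (fiberι f t) (2 * 2)).hom →
      ξ ∈ (algebraicClasses 𝒳 2).map (complexBetti.map (fiberι f t) (2 * 2)).hom := by
  obtain ⟨A₀, ⟨e₀⟩, hdim, hcm⟩ := ht
  exact numerical_two_two_iff_primitiveLift_two_of_hodge hf t hKalg hK hKt
    fun c hc hcpp ↦ Ring2Transport.mem_algebraicClasses_of_cmChart hCM A₀ e₀ hdim hcm hc hcpp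

/-- **`d = 4`: Abdulali's (1.1)_f for a compact pencil of abelian fourfolds from the primitive `(2,2)`-lift at every point.**
[cite: Abdulali1994FamiliesAV, (1.1) and p. 1122] [cite: Lieberman1968, Thm. 1] -/
theorem invariantCyclesHoldFor_of_relDim_four_of_primitiveLift_two {f : 𝒳 ⟶ S} (hf : IsCompactAbelianPencil f 4)
    {K : complexBetti 𝒳 2} (hKalg : K ∈ algebraicClasses 𝒳 1)
    (hKs : ∀ s : ComplexPoints S, IsPolarizationClass 4 (fiberOver f s) (complexBetti.map (fiberι f s) 2 K))
    (hPrim : ∀ (s : ComplexPoints S), ∀ ξ ∈ algebraicClasses (fiberOver f s) 2,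
      ξ ∈ primitiveClasses (complexBetti.map (fiberι f s) 2 K) 4 (2 * 2) →
      ξ ∈ LinearMap.range (complexBetti.map (fiberι f s) (2 * 2)).hom →
      ξ ∈ (algebraicClasses 𝒳 2).map (complexBetti.map (fiberι f s) (2 * 2)).hom) :
    InvariantCyclesHoldFor f 4 := by
  have hK : ∀ s : ComplexPoints S, HasHardLefschetzProperty (complexBetti.map (fiberι f s) 2 K) 4 :=
    fun s ↦ (hKs s).hasHardLefschetz
  rw [invariantCyclesHoldFor_iff_comap_eq hf]
  intro p s s'
  rw [le_antisymm (comap_le_sup_of_relDim_four_of_primitiveLift_two hf s hKalg hK (hKs s) (hPrim s) p)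
      (algebraicClasses_sup_ker_le_comap hf p s),
    le_antisymm (comap_le_sup_of_relDim_four_of_primitiveLift_two hf s' hKalg hK (hKs s') (hPrim s') p)
      (algebraicClasses_sup_ker_le_comap hf p s'),
    algebraicClasses_sup_ker_eq hf p s s']

/-! ## §5 All degrees at a fibre satisfying the Hodge conjecture (e.g. a CM fibre under `HC_CM`) -/

/-- **AT A FIBRE SATISFYING HC: [(Num_t)(p,q) for all `p + q = d`] ⟺ [(Prim)_t(r) for all `4 ≤ 2r ≤ d`]** (`A(X_t, κ)`
from the Hodge conjecture of the fibre, the tree's `standardConjectureA_of_hodgeClasses_algebraic`; exactness of part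
XVIII-c degree by degree). [cite: Kleiman1968AlgebraicCycles, §3] [cite: Grothendieck1968, §3 p. 196]
[cite: Milne2020HodgeClassesAV, Prop. 1 (p. 7)] -/
theorem forall_numerical_iff_primitiveLift_of_hodge {d : ℕ} {f : 𝒳 ⟶ S} (hf : IsCompactAbelianPencil f d)
    (t : ComplexPoints S) {K : complexBetti 𝒳 2} (hKalg : K ∈ algebraicClasses 𝒳 1)
    (hK : ∀ s : ComplexPoints S, HasHardLefschetzProperty (complexBetti.map (fiberι f s) 2 K) d)
    (hKt : IsPolarizationClass d (fiberOver f t) (complexBetti.map (fiberι f t) 2 K))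
    (hHC : ∀ (p : ℕ) (c : complexBetti (fiberOver f t) (2 * p)), IsRationalClass c →
      IsOfHodgeType d (fiberOver f t) (2 * p) p p c → c ∈ algebraicClasses (fiberOver f t) p) :
    (∀ (p q : ℕ) (hpq : p + q = d), ∀ b ∈ algebraicClasses (fiberOver f t) q,
      (∀ a ∈ algebraicClasses 𝒳 p,
        cupProduct (show 2 * p + 2 * (q + 1) = 2 * (d + 1) by omega) a (fiberGysin hf t q b) = 0) →
        fiberGysin hf t q b = 0) ↔
    ∀ r, 2 ≤ r → 2 * r ≤ d → ∀ ξ ∈ algebraicClasses (fiberOver f t) r,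
      ξ ∈ primitiveClasses (complexBetti.map (fiberι f t) 2 K) d (2 * r) →
      ξ ∈ LinearMap.range (complexBetti.map (fiberι f t) (2 * r)).hom →
      ξ ∈ (algebraicClasses 𝒳 r).map (complexBetti.map (fiberι f t) (2 * r)).hom := by
  have hXt := hf.isSmoothProjective_fiberOver t
  have hAt : StandardConjectureA d (fiberOver f t) (complexBetti.map (fiberι f t) 2 K) :=
    standardConjectureA_of_hodgeClasses_algebraic hXt hKt fun p _ c hc hpp ↦ hHC p c hc hpp
  rw [← forall_comap_le_sup_iff_primitiveLift_of_standardConjectureA hf t hKalg hK hKt hAt]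
  refine ⟨fun h p ↦ ?_, fun h p q hpq ↦ ?_⟩
  · rcases le_or_gt p d with hp | hp
    · exact (numerical_iff_comap_le_sup_of_hodge hf t (show p + (d - p) = d by omega) (hHC p) (hHC (d - p))).1
        (h p (d - p) (by omega))
    · exact comap_le_sup_of_relDim_lt hf t hp
  · exact (numerical_iff_comap_le_sup_of_hodge hf t hpq (hHC p) (hHC q)).2 (h p)

/-- **AT A CM POINT UNDER `HC_CM` (a BINDER): [(Num_t) in all bidegrees] ⟺ [(Prim)_t(r) for all `4 ≤ 2r ≤ d`].**
[cite: Andre1996Motifs, §6.3 a) (p. 33)] [cite: Kleiman1968AlgebraicCycles, §3] -/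
theorem forall_numerical_iff_primitiveLift_of_HC_CM (hCM : RankFourFaces.CMAbelianHodge) {d : ℕ} {f : 𝒳 ⟶ S}
    (hf : IsCompactAbelianPencil f d) {t : ComplexPoints S} (ht : t ∈ cmLocus f d) {K : complexBetti 𝒳 2}
    (hKalg : K ∈ algebraicClasses 𝒳 1)
    (hK : ∀ s : ComplexPoints S, HasHardLefschetzProperty (complexBetti.map (fiberι f s) 2 K) d)
    (hKt : IsPolarizationClass d (fiberOver f t) (complexBetti.map (fiberι f t) 2 K)) :
    (∀ (p q : ℕ) (hpq : p + q = d), ∀ b ∈ algebraicClasses (fiberOver f t) q,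
      (∀ a ∈ algebraicClasses 𝒳 p,
        cupProduct (show 2 * p + 2 * (q + 1) = 2 * (d + 1) by omega) a (fiberGysin hf t q b) = 0) →
        fiberGysin hf t q b = 0) ↔
    ∀ r, 2 ≤ r → 2 * r ≤ d → ∀ ξ ∈ algebraicClasses (fiberOver f t) r,
      ξ ∈ primitiveClasses (complexBetti.map (fiberι f t) 2 K) d (2 * r) →
      ξ ∈ LinearMap.range (complexBetti.map (fiberι f t) (2 * r)).hom →
      ξ ∈ (algebraicClasses 𝒳 r).map (complexBetti.map (fiberι f t) (2 * r)).hom := by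
  obtain ⟨A₀, ⟨e₀⟩, hdim, hcm⟩ := ht
  exact forall_numerical_iff_primitiveLift_of_hodge hf t hKalg hK hKt
    fun p c hc hpp ↦ Ring2Transport.mem_algebraicClasses_of_cmChart hCM A₀ e₀ hdim hcm hc hpp

/-! ## §6 Node level: under `HC_CM`, (L) ⟺ Num^CM ⟺ the CM primitive lift; the cell row; on-path; exactness mod Verdier -/

/-- Display-only shape of the CM PRIMITIVE LIFT (no `def` is made): on every compact pencil of abelian `d`-folds, at every
CM point `t`, for every global algebraic class `K` polarising every fibre and every `2 ≤ r ≤ d/2`, every `K|_{X_t}`-primitive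
algebraic class of degree `2r` on `X_t` lying in `Im j_t^*` lies in `j_t^* N^r(𝒳)`. -/
local notation3 (prettyPrint := false) "CMPrimitiveLift[]" =>
  ∀ ⦃d : ℕ⦄ ⦃𝒳 S : SchemeOver ℂ⦄ (f : 𝒳 ⟶ S) (_ : IsCompactAbelianPencil f d) (t : ComplexPoints S),
    t ∈ cmLocus f d → ∀ (K : complexBetti 𝒳 2), K ∈ algebraicClasses 𝒳 1 →
    (∀ s : ComplexPoints S, IsPolarizationClass d (fiberOver f s) (complexBetti.map (fiberι f s) 2 K)) →
    ∀ r, 2 ≤ r → 2 * r ≤ d → ∀ ξ ∈ algebraicClasses (fiberOver f t) r,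
      ξ ∈ primitiveClasses (complexBetti.map (fiberι f t) 2 K) d (2 * r) →
      ξ ∈ LinearMap.range (complexBetti.map (fiberι f t) (2 * r)).hom →
      ξ ∈ (algebraicClasses 𝒳 r).map (complexBetti.map (fiberι f t) (2 * r)).hom

/-- **(L) ⟹ the CM primitive lift** — fact-free and `HC_CM`-free (the lift contains the primitive lift).
[cite: Milne2020HodgeClassesAV, Prop. 1 (p. 7)] -/
theorem cmPrimitiveLift_of_cmFibreAlgebraicLift (hL : CMFibreAlgebraicLift) : CMPrimitiveLift[] := by
  intro d 𝒳 S f hf t ht K _ _ r _ _ ξ hξ _ hrange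
  exact mem_map_algebraicClasses_of_comap_le_sup hf t (cmFibreAlgebraicLift_iff_comap_le_sup.1 hL f hf r t ht) hξ hrange

/-- **`HC_CM ⊢` the CM primitive lift ⟹ (L)** (`HC_CM` a BINDER: it supplies `A(X_t, κ)` at the CM fibre through the Hodge
conjecture of the CM fibre; §3 supplies the global polarising class). [cite: Andre1996Motifs, §6.3 a) (p. 33)]
[cite: Kleiman1968AlgebraicCycles, §3] [cite: Grothendieck1968, §3 p. 196] -/
theorem cmFibreAlgebraicLift_of_cmPrimitiveLift_of_HC_CM (hCM : RankFourFaces.CMAbelianHodge)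
    (hPrim : CMPrimitiveLift[]) : CMFibreAlgebraicLift := by
  refine cmFibreAlgebraicLift_iff_comap_le_sup.2 fun d 𝒳 S f hf p t ht ↦ ?_
  obtain ⟨K, hKalg, -, hKs⟩ := exists_algebraic_globalPolarization hf
  obtain ⟨A₀, ⟨e₀⟩, hdim, hcm⟩ := ht
  have hAt : StandardConjectureA d (fiberOver f t) (complexBetti.map (fiberι f t) 2 K) :=
    standardConjectureA_of_hodgeClasses_algebraic (hf.isSmoothProjective_fiberOver t) (hKs t)
      fun p _ c hc hpp ↦ Ring2Transport.mem_algebraicClasses_of_cmChart hCM A₀ e₀ hdim hcm hc hpp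
  exact (forall_comap_le_sup_iff_primitiveLift_of_standardConjectureA hf t hKalg (fun s ↦ (hKs s).hasHardLefschetz)
    (hKs t) hAt).2 (hPrim f hf t ⟨A₀, ⟨e₀⟩, hdim, hcm⟩ K hKalg hKs) p

/-- **`HC_CM ⊢ (L) ⟺` the CM primitive lift.** [cite: Andre1996Motifs, §6.3 a) (p. 33)] [cite: Kleiman1968AlgebraicCycles, §3] -/
theorem cmFibreAlgebraicLift_iff_cmPrimitiveLift_of_HC_CM (hCM : RankFourFaces.CMAbelianHodge) :
    CMFibreAlgebraicLift ↔ CMPrimitiveLift[] :=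
  ⟨cmPrimitiveLift_of_cmFibreAlgebraicLift, cmFibreAlgebraicLift_of_cmPrimitiveLift_of_HC_CM hCM⟩

/-- **`HC_CM ⊢ Num^CM ⟺` the CM primitive lift**: conjecture D for the CM-fibre-supported cycles of the total spaces, in
every bidegree, IS the lift of the monodromy-invariant primitive algebraic classes of degrees `4 ≤ 2r ≤ d` of the CM fibres.
[cite: Kleiman1968AlgebraicCycles, §3 (D(X))] [cite: Andre1996Motifs, §6.3 (p. 33)] -/
theorem cmPointedPencilNumerical_iff_cmPrimitiveLift_of_HC_CM (hCM : RankFourFaces.CMAbelianHodge) :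
    CMPointedPencilNumerical ↔ CMPrimitiveLift[] :=
  (cmFibreAlgebraicLift_iff_cmPointedPencilNumerical_of_HC_CM hCM).symm.trans
    (cmFibreAlgebraicLift_iff_cmPrimitiveLift_of_HC_CM hCM)

/-- **THE CELL ROW THROUGH THE PRIMITIVE LIFT: `h₂₁ → HC_CM → [CM primitive lift] → HC_AV`.** `HC_CM` and `h₂₁` (André's
Lemme 6.3.1) are BINDERS; the bracket is this part's reading of `B_min`: finitely many find-the-cycle problems per CM-pointed
pencil, one for each invariant PRIMITIVE algebraic class of the CM fibre in degrees `4 ≤ 2r ≤ d`. research route, not a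
corollary; conditional on HC_CM plus one named minimal statement. [cite: Andre1996Motifs, Lemme 6.3.1 (p. 31) and §6.3 (p. 33)]
[cite: Milne2020HodgeClassesAV, Prop. 1 (p. 7)] -/
theorem HC_AV_of_HC_CM_of_cmPrimitiveLift (h₂₁ : andre1996_cmAnchoredPencil) (hCM : RankFourFaces.CMAbelianHodge)
    (hPrim : CMPrimitiveLift[]) : PadicSemiregularLift.HodgeAbelianVarieties :=
  HC_AV_of_HC_CM_and_cmFibreAlgebraicLift h₂₁ hCM (cmFibreAlgebraicLift_of_cmPrimitiveLift_of_HC_CM hCM hPrim)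

/-- **ON-PATH: `HodgeConjecture ⟹` the CM primitive lift** (a CASE of the summit statement; nothing here is summit-progress
rhetoric). [cite: Andre1996Motifs, §6.3 (p. 33)] -/
theorem cmPrimitiveLift_of_hodgeConjecture (h : _root_.HodgeConjecture) : CMPrimitiveLift[] :=
  cmPrimitiveLift_of_cmFibreAlgebraicLift (cmFibreAlgebraicLift_of_hodgeConjecture h)

/-- **EXACTNESS modulo Lemme 6.3.1 and Verdier 1976 (both BINDERS): `HC_AV ⟺ HC_CM ∧ [CM primitive lift]`** (part XX-a's
`HC_AV_iff_HC_CM_and_cmFibreAlgebraicLift_of_verdier` read through §6). [cite: Andre1996Motifs, Lemme 6.3.1 (p. 31)]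
[cite: Verdier1976, Cor. (5.1)] -/
theorem HC_AV_iff_HC_CM_and_cmPrimitiveLift_of_verdier (h₂₁ : andre1996_cmAnchoredPencil)
    (hGT : Verdier1976_genericLocalTriviality) :
    PadicSemiregularLift.HodgeAbelianVarieties ↔ (RankFourFaces.CMAbelianHodge ∧ CMPrimitiveLift[]) := by
  rw [HC_AV_iff_HC_CM_and_cmFibreAlgebraicLift_of_verdier h₂₁ hGT]
  exact ⟨fun h ↦ ⟨h.1, cmPrimitiveLift_of_cmFibreAlgebraicLift h.2⟩,
    fun h ↦ ⟨h.1, cmFibreAlgebraicLift_of_cmPrimitiveLift_of_HC_CM h.1 h.2⟩⟩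

/-- The item reading: granted `h₂₁`, [CM primitive lift] ⟹ `CMToAbelian` (stmt-HodgeConjecture-16267); nothing closes the item.
[cite: Andre1996Motifs, Remarque 2 (p. 33)] -/
theorem cmToAbelian_of_andre1996_of_cmPrimitiveLift (h₂₁ : andre1996_cmAnchoredPencil) (hPrim : CMPrimitiveLift[]) :
    RankFourFaces.CMToAbelian :=
  fun hCM A _ ↦ HC_AV_of_HC_CM_of_cmPrimitiveLift h₂₁ hCM hPrim A

/-! ## §7 `E`-power points (no `HC_CM`): the lift, `NumE` and the W₆ bracket through the primitive lift -/

/-- `NumE[d, p, q]` — part XIX-f's hypothesis shape VERBATIM ((Num_t)(p,q) at the `E`-power points of compact pencils of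
abelian `d`-folds); a local notation, not a definition. [cite: Kleiman1968AlgebraicCycles, §3 (D(X))] -/
local notation3 (prettyPrint := false) "NumE[" d ", " p ", " q "]" =>
  ∀ ⦃𝒳 S : SchemeOver ℂ⦄ (f : 𝒳 ⟶ S) (hf : IsCompactAbelianPencil f d) (t : ComplexPoints S),
    t ∈ cmPowerLocus f d → ∀ (hpq : p + q = d), ∀ b ∈ algebraicClasses (fiberOver f t) q,
      (∀ a ∈ algebraicClasses 𝒳 p,
        cupProduct (two_mul_add_two_mul_succ_eq hpq) a (fiberGysin hf t q b) = 0) →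
        fiberGysin hf t q b = 0

/-- `PrimE[d]` — (Prim)_t(r) for all `4 ≤ 2r ≤ d` at the `E`-power points of compact pencils of abelian `d`-folds, for
every global algebraic class polarising every fibre; display-only local notation, not a definition.
[cite: Kleiman1968AlgebraicCycles, §3] [cite: vanGeemen1994HodgeAV, Thm. 4.3] -/
local notation3 (prettyPrint := false) "PrimE[" d "]" =>
  ∀ ⦃𝒳 S : SchemeOver ℂ⦄ (f : 𝒳 ⟶ S) (_ : IsCompactAbelianPencil f d) (t : ComplexPoints S),
    t ∈ cmPowerLocus f d → ∀ (K : complexBetti 𝒳 2), K ∈ algebraicClasses 𝒳 1 →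
    (∀ s : ComplexPoints S, IsPolarizationClass d (fiberOver f s) (complexBetti.map (fiberι f s) 2 K)) →
    ∀ r, 2 ≤ r → 2 * r ≤ d → ∀ ξ ∈ algebraicClasses (fiberOver f t) r,
      ξ ∈ primitiveClasses (complexBetti.map (fiberι f t) 2 K) d (2 * r) →
      ξ ∈ LinearMap.range (complexBetti.map (fiberι f t) (2 * r)).hom →
      ξ ∈ (algebraicClasses 𝒳 r).map (complexBetti.map (fiberι f t) (2 * r)).hom

/-- **At an `E`-power point the primitive lifts give the lift in EVERY degree, with NO binder**: `A(X_t, κ)` holds because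
the Hodge conjecture of the fibre `≅ Eᴺ` (`E` CM) is a tree theorem. [cite: vanGeemen1994HodgeAV, Lemma 3.7 and Thm. 4.3]
[cite: Grothendieck1968, §3 p. 196] [cite: Kleiman1968AlgebraicCycles, §3] -/
theorem comap_le_sup_of_primitiveLift_of_mem_cmPowerLocus {d : ℕ} {f : 𝒳 ⟶ S} (hf : IsCompactAbelianPencil f d)
    {t : ComplexPoints S} (ht : t ∈ cmPowerLocus f d) {K : complexBetti 𝒳 2} (hKalg : K ∈ algebraicClasses 𝒳 1)
    (hKs : ∀ s : ComplexPoints S, IsPolarizationClass d (fiberOver f s) (complexBetti.map (fiberι f s) 2 K))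
    (hPrim : ∀ r, 2 ≤ r → 2 * r ≤ d → ∀ ξ ∈ algebraicClasses (fiberOver f t) r,
      ξ ∈ primitiveClasses (complexBetti.map (fiberι f t) 2 K) d (2 * r) →
      ξ ∈ LinearMap.range (complexBetti.map (fiberι f t) (2 * r)).hom →
      ξ ∈ (algebraicClasses 𝒳 r).map (complexBetti.map (fiberι f t) (2 * r)).hom) (p : ℕ) :
    (algebraicClasses (fiberOver f t) p).comap (complexBetti.map (fiberι f t) (2 * p)).hom ≤
      algebraicClasses 𝒳 p ⊔ LinearMap.ker (complexBetti.map (fiberι f t) (2 * p)).hom :=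
  (forall_comap_le_sup_iff_primitiveLift_of_standardConjectureA hf t hKalg (fun s ↦ (hKs s).hasHardLefschetz) (hKs t)
    (standardConjectureA_of_hodgeConjectureFor (hf.isSmoothProjective_fiberOver t) (hKs t)
      (hodgeConjectureFor_fiberOver_of_mem_cmPowerLocus ht))).2 hPrim p

/-- **`PrimE[d] ⟹ NumE[d, p, q]` in every bidegree** (exactness of part XVIII-c at the HC fibre `≅ Eᴺ`; no `HC_CM`, no
named fact, no spreading). [cite: Kleiman1968AlgebraicCycles, §3 (D(X))] [cite: vanGeemen1994HodgeAV, Thm. 4.3] -/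
theorem numericalE_of_primitiveLiftE {d : ℕ} (hPrim : PrimE[d]) (p q : ℕ) : NumE[d, p, q] := by
  intro 𝒳 S f hf t ht hpq b hb hab
  obtain ⟨K, hKalg, -, hKs⟩ := exists_algebraic_globalPolarization hf
  have hHC := hodgeConjectureFor_fiberOver_of_mem_cmPowerLocus ht
  exact numerical_of_comap_le_sup_of_hodge hf t hpq (fun c hc hpp ↦ hHC.2 p c hc hpp)
    (comap_le_sup_of_primitiveLift_of_mem_cmPowerLocus hf ht hKalg hKs (hPrim f hf t ht K hKalg hKs) p) b hb hab

/-- **`(W_E)₃ ∧ PrimE[6] ⟹ WeilSixfolds`** — the Weil-sixfold item from the lift of the invariant PRIMITIVE algebraic classes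
of `H⁴(E⁶)` and `H⁶(E⁶)` at the `E`-power points of compact pencils of abelian sixfolds (through part XIX-f's row; as a
theorem weaker-or-equal to it, `PrimE[6] ⟹ NumE[6,3,3]`); NO `HC_CM`, NO named fact; nothing is closed — `(W_E)₃` is an
OPEN habitat node (part IX). research route, not a corollary; conditional on HC_CM plus one named minimal statement (here
`HC_CM` is IDLE). [cite: Kleiman1968AlgebraicCycles, §3 (D(X))] [cite: Andre1996Motifs, Lemme 6.3.3 (p. 33)]
[cite: vanGeemen1994HodgeAV, Thm. 4.3 and 5.12] -/
theorem weilSixfolds_of_cmPowerWeilPencilsAt_of_primitiveLiftE (hW : CMPowerAnchoredCompactWeilPencilsAt 3)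
    (hPrim : PrimE[6]) : Theses.SevenfoldWeilCensus.WeilSixfolds :=
  weilSixfolds_of_cmPowerWeilPencilsAt_of_numerical hW (numericalE_of_primitiveLiftE hPrim 3 3)

/-- **ON-PATH: `HodgeConjecture ⟹ PrimE[d]`** (the lift at every point from part VI's algebraic fixed part).
[cite: Andre1996Motifs, §6.3 (p. 33)] -/
theorem primitiveLiftE_of_hodgeConjecture (h : _root_.HodgeConjecture) (d : ℕ) : PrimE[d] := by
  intro 𝒳 S f hf t _ K _ _ r _ _ ξ hξ _ hrange
  exact mem_map_algebraicClasses_of_comap_le_sup hf t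
    (le_of_eq (algebraicFixedPart_iff_comap_eq_sup.1 (algebraicFixedPart_of_hodgeConjecture h) f hf r t)) hξ hrange

end Summit.HodgeConjecture.HodgeConjecture.Ring2.AbelianAll

end
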